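import Literature.AnabelianGeometry.EtaleTheta.ThetaCoversTempered
import Literature.AnabelianGeometry.EtaleTheta.ThetaCoversHeisenbergWitness
import Mathlib.Data.Nat.Factorial.Basic
import Mathlib.GroupTheory.SemidirectProduct
import Mathlib.Topology.Algebra.OpenSubgroup

/-!
# The LAMPLIGHTER MODEL of the tempered theta-covering interface `ThetaCovers.TemperedCoverData` ([EtTh] §2),
# part 1 (DEF-BEARING): the coherent lamplighter tower `Q̂`, the finite factor `A`, and the tempered side `Q₀ ⊆ Q̂ × ℤ`

S. Mochizuki, *The étale theta function and its Frobenioid-theoretic manifestations*, Publ. RIMS **45** (2009)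
[MochizukiEtTh2009], §2: Def. 2.5 (PDF pp. 39–40) and Lemma 2.17 (ii) (PDF p. 58): «for `Π` the tempered fundamental group
of a hyperbolic orbicurve over a finite extension of `ℚ_p` and `H ⊆ Π` an open subgroup, `N_{Π̂}(H) = N_Π(H)`»
[cite: MochizukiEtTh2009, Lem 2.17(ii) p.58].  abc-iut cell, block F (FACT-PROVING WAVE, instance forms), seat abc-iut-f-142
(tranche 142, row **F-0606** `ThetaCovers.TemperedCoverData.Lem217_ii`, trunk `ThetaCoversTempered.lean` of abc-iut-L2-t2).
F-0606 is a `parametrised` schema over `T : TemperedCoverData l`; its universal closure is REFUTED (abc-iut-f-142,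
`Discharge/Sec2Lem217iiClosureRefuted.lean`) and — before this series — NO carrier in the tree satisfied it (abc-iut-f-108's
`Lem217iiNecessary.lean`: every carrier with compact `Π^tp_Y` refutes it).  This series of files builds a carrier at which
the typed Lemma 2.17 (ii) HOLDS (`Discharge/Sec2Lem217iiTrueAtLampModel.lean`), so that the row is INDEPENDENT of the interface.

THE MODEL (this file = its raw materials; new type synonyms/subgroups only, instances only on them).
* Levels `W_n := (ℤ/N_n → S₃) ⋊ ℤ/N_n`, `N_n := (n+1)!` (finite lamplighter groups; Mathlib's `SemidirectProduct`, discrete).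
* `Q̂ ⊆ ∏ₙ W_n`: the sequences with COHERENT rotation parts (`a_{n+1} ≡ a_n mod N_n`) — a closed subgroup, hence a
  profinite group; its rotation parts form `lim ℤ/N_n = Ẑ`.
* `A := heisPiC l` (abc-iut-w5-d243's Heisenberg toy `(ℤ/l × ℤ/l) ⋊ D_l`) as a DISCRETE type synonym, and
  `Φ := fst : A × Q̂ → heisPiC l` (the toy's cover data are pulled back along `Φ` in part 2).
* `Q₀ ⊆ Q̂ × ℤ`: pairs `(q, k)` with rotation parts EQUAL to the integer `k` at every level and lamp configurations
  POSITION-WISE EVENTUALLY CONSTANT along the integer positions (`EvC`); `deg (q, k) = k`, `ι (q, k) = q`.  As a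
  subgroup of `Q̂ × ℤ` it carries the topology making `deg` continuous: `Ker deg` is OPEN and NOT compact — exactly the
  shape abc-iut-f-108 showed a serving carrier must have.
* Named elements: `mkQ m k`, `mkQt m k`, the rotations `ζ^k = zetaHom k`, the basic open normal subgroups `lev N` of `Q̂`.

HONEST FRAMING. A DESIGNED consistency witness for OUR typed interface (`G_K = 1`; lamplighter groups, not
fundamental groups of curves): it decides which typed sentences are CONSEQUENCES of the interface and which are not;
nothing of [EtTh] is asserted or denied for genuine tempered fundamental groups; instance-at-a-designed-carrier ≠ the
printed lemma; no side is taken on [IUTchIII] Cor. 3.12 or on any author; nothing here bears on abc. typed ≠ proved.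
-/

noncomputable section

namespace Literature.AnabelianGeometry.EtaleTheta

namespace ThetaCovers

namespace LampModel

section Part_1

open Multiplicative

/-! ## 1. Levels: the finite lamplighter groups `W_n = (ℤ/N_n → S₃) ⋊ ℤ/N_n`, `N_n = (n+1)!` -/

/-- The lamp group `S₃` (permutations of three letters). (toy bookkeeping for the typed interface of
[EtTh] §2; no claim about print) [cite: MochizukiEtTh2009, Lem 2.17(ii) p.58] -/
abbrev S : Type := Equiv.Perm (Fin 3)

/-- The modulus `N_n := (n+1)!` of level `n` (so that `N_m ∣ N_n` for `m ≤ n` and every `d ≥ 1` divides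
some `N_n`: the rotation tower completes to `Ẑ`). (toy bookkeeping) [cite: MochizukiEtTh2009, Lem 2.17(ii) p.58] -/
def Nl (n : ℕ) : ℕ := (n + 1).factorial

/-- `N_n > 0`. (toy bookkeeping) [cite: MochizukiEtTh2009, Lem 2.17(ii) p.58] -/
theorem Nl_pos (n : ℕ) : 0 < Nl n := Nat.factorial_pos _

/-- `N_n ≠ 0`, as an instance for `ZMod (N_n)`. (toy bookkeeping) [cite: MochizukiEtTh2009, Lem 2.17(ii) p.58] -/
instance (n : ℕ) : NeZero (Nl n) := ⟨(Nl_pos n).ne'⟩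

/-- `N_m ∣ N_n` for `m ≤ n`. (toy bookkeeping) [cite: MochizukiEtTh2009, Lem 2.17(ii) p.58] -/
theorem Nl_dvd {m n : ℕ} (h : m ≤ n) : Nl m ∣ Nl n := Nat.factorial_dvd_factorial (by omega)

/-- `d ∣ N_n` as soon as `0 < d ≤ n + 1`. (toy bookkeeping) [cite: MochizukiEtTh2009, Lem 2.17(ii) p.58] -/
theorem dvd_Nl {d n : ℕ} (hd : 0 < d) (h : d ≤ n + 1) : d ∣ Nl n := Nat.dvd_factorial hd h

/-- `n < N_n`. (toy bookkeeping) [cite: MochizukiEtTh2009, Lem 2.17(ii) p.58] -/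
theorem lt_Nl (n : ℕ) : n < Nl n := by
  have := Nat.self_le_factorial (n + 1)
  unfold Nl; omega

/-- `N_0 = 1`. (toy bookkeeping) [cite: MochizukiEtTh2009, Lem 2.17(ii) p.58] -/
theorem Nl_zero : Nl 0 = 1 := rfl

/-- Lamp configurations of level `n`: functions `ℤ/N_n → S₃`. (toy bookkeeping)
[cite: MochizukiEtTh2009, Lem 2.17(ii) p.58] -/
abbrev F (n : ℕ) : Type := ZMod (Nl n) → S

/-- The rotation action of `ℤ/N_n` on level-`n` configurations: `(a • f) j = f (j - a)`. (toy bookkeeping)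
[cite: MochizukiEtTh2009, Lem 2.17(ii) p.58] -/
def rot (n : ℕ) : Multiplicative (ZMod (Nl n)) →* MulAut (F n) where
  toFun a :=
    { toFun := fun f j => f (j - toAdd a)
      invFun := fun f j => f (j + toAdd a)
      left_inv := fun f => funext fun j => by simp
      right_inv := fun f => funext fun j => by simp
      map_mul' := fun _ _ => rfl }
  map_one' := MulEquiv.ext fun f => funext fun j => by
    change f (j - toAdd (1 : Multiplicative (ZMod (Nl n)))) = f j
    rw [toAdd_one, sub_zero]
  map_mul' a b := MulEquiv.ext fun f => funext fun j => by
    change f (j - (toAdd a + toAdd b)) = f (j - toAdd a - toAdd b)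
    rw [← sub_sub]

/-- `(a • f) j = f (j - a)`. (toy bookkeeping) [cite: MochizukiEtTh2009, Lem 2.17(ii) p.58] -/
@[simp] theorem rot_apply (n : ℕ) (a : Multiplicative (ZMod (Nl n))) (f : F n) (j : ZMod (Nl n)) :
    rot n a f j = f (j - toAdd a) := rfl

/-- The level-`n` lamplighter group `W_n := (ℤ/N_n → S₃) ⋊ ℤ/N_n` (Mathlib's `SemidirectProduct`).
(toy bookkeeping) [cite: MochizukiEtTh2009, Lem 2.17(ii) p.58] -/
abbrev W (n : ℕ) : Type := F n ⋊[rot n] Multiplicative (ZMod (Nl n))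

/-- `W_n` carries the DISCRETE topology. (toy bookkeeping) [cite: MochizukiEtTh2009, Lem 2.17(ii) p.58] -/
instance (n : ℕ) : TopologicalSpace (W n) := ⊥

/-- `W_n` is discrete. (toy bookkeeping) [cite: MochizukiEtTh2009, Lem 2.17(ii) p.58] -/
instance (n : ℕ) : DiscreteTopology (W n) := ⟨rfl⟩

/-- `W_n` is finite. (toy bookkeeping) [cite: MochizukiEtTh2009, Lem 2.17(ii) p.58] -/
instance (n : ℕ) : Finite (W n) := Finite.of_equiv _ (SemidirectProduct.equivProd).symm

/-! ## 2. The coherent tower `Q̂ ⊆ ∏ₙ W_n` (a profinite group) -/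

/-- The full product `∏ₙ W_n` (compact, Hausdorff, totally disconnected). (toy bookkeeping)
[cite: MochizukiEtTh2009, Lem 2.17(ii) p.58] -/
abbrev Qfull : Type := ∀ n, W n

/-- The reduction `ℤ/N_{n+1} → ℤ/N_n`. (toy bookkeeping) [cite: MochizukiEtTh2009, Lem 2.17(ii) p.58] -/
def red (n : ℕ) : ZMod (Nl (n + 1)) →+* ZMod (Nl n) := ZMod.castHom (Nl_dvd (Nat.le_succ n)) _

/-- **`Q̂`**: the sequences of `∏ₙ W_n` whose rotation parts are COHERENT (`a_{n+1} ≡ a_n mod N_n`), so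
that the rotation parts form `lim ℤ/N_n = Ẑ`. (toy bookkeeping) [cite: MochizukiEtTh2009, Lem 2.17(ii) p.58] -/
def Qhat : Subgroup Qfull where
  carrier := {q | ∀ n, red n (toAdd (q (n + 1)).right) = toAdd (q n).right}
  one_mem' := fun n => by simp
  mul_mem' {q q'} hq hq' n := by
    simp only [Pi.mul_apply, SemidirectProduct.mul_right, toAdd_mul, map_add, hq n, hq' n]
  inv_mem' {q} hq n := by
    simp only [Pi.inv_apply, SemidirectProduct.inv_right, toAdd_inv, map_neg, hq n]

/-- Membership in `Q̂`. (toy bookkeeping) [cite: MochizukiEtTh2009, Lem 2.17(ii) p.58] -/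
theorem mem_Qhat {q : Qfull} : q ∈ Qhat ↔ ∀ n, red n (toAdd (q (n + 1)).right) = toAdd (q n).right :=
  Iff.rfl

/-- `Q̂` is closed in `∏ₙ W_n`. (toy bookkeeping) [cite: MochizukiEtTh2009, Lem 2.17(ii) p.58] -/
theorem isClosed_Qhat : IsClosed (Qhat : Set Qfull) := by
  have : (Qhat : Set Qfull) = ⋂ n, {q : Qfull | red n (toAdd (q (n + 1)).right) = toAdd (q n).right} := by
    ext q; simp [mem_Qhat]
  rw [this]
  refine isClosed_iInter fun n => ?_
  have hc : Continuous fun q : Qfull => (q (n + 1), q n) := (continuous_apply _).prodMk (continuous_apply _)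
  exact (isClosed_discrete {p : W (n + 1) × W n | red n (toAdd p.1.right) = toAdd p.2.right}).preimage hc

/-- `Q̂` as a type. (toy bookkeeping) [cite: MochizukiEtTh2009, Lem 2.17(ii) p.58] -/
abbrev Qc : Type := ↥Qhat

/-- `Q̂` is compact (a closed subgroup of the profinite `∏ₙ W_n`). (toy bookkeeping)
[cite: MochizukiEtTh2009, Lem 2.17(ii) p.58] -/
instance : CompactSpace Qc := isCompact_iff_compactSpace.mp isClosed_Qhat.isCompact

/-! ## 3. The finite factor `A := heisPiC l` with the discrete topology -/

/-- Type synonym of abc-iut-w5-d243's Heisenberg toy group `heisPiC l = (ℤ/l × ℤ/l) ⋊ D_l`, made to carry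
the DISCRETE topology (instances only on this new synonym). (toy bookkeeping) [cite: MochizukiEtTh2009, Def 2.1 p.36] -/
def A (l : ℕ) : Type := HeisenbergWitness.heisPiC l

/-- `A` is a group (the toy's). (toy bookkeeping) [cite: MochizukiEtTh2009, Def 2.1 p.36] -/
instance (l : ℕ) : Group (A l) := inferInstanceAs (Group (HeisenbergWitness.heisPiC l))

/-- `A` carries the DISCRETE topology. (toy bookkeeping) [cite: MochizukiEtTh2009, Def 2.1 p.36] -/
instance (l : ℕ) : TopologicalSpace (A l) := ⊥

/-- `A` is discrete. (toy bookkeeping) [cite: MochizukiEtTh2009, Def 2.1 p.36] -/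
instance (l : ℕ) : DiscreteTopology (A l) := ⟨rfl⟩

/-- `A` is finite (`l ≠ 0`). (toy bookkeeping) [cite: MochizukiEtTh2009, Def 2.1 p.36] -/
instance (l : ℕ) [NeZero l] : Finite (A l) :=
  Finite.of_equiv _ (SemidirectProduct.equivProd (N := Multiplicative (ZMod l × ZMod l))
    (G := DihedralGroup l) (φ := HeisenbergWitness.theta l)).symm

/-- The identity `A → heisPiC l` across the type synonym. (toy bookkeeping) [cite: MochizukiEtTh2009, Def 2.1 p.36] -/
def toHeis (l : ℕ) : A l →* HeisenbergWitness.heisPiC l where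
  toFun a := a
  map_one' := rfl
  map_mul' _ _ := rfl

/-- `Φ : A × Q̂ → heisPiC l`, the first projection (the surjection along which the toy's cover data are
pulled back). (toy bookkeeping) [cite: MochizukiEtTh2009, Def 2.1 p.36] -/
def Φ (l : ℕ) : A l × Qc →* HeisenbergWitness.heisPiC l := (toHeis l).comp (MonoidHom.fst (A l) Qc)

/-- `Φ` is onto. (toy bookkeeping) [cite: MochizukiEtTh2009, Def 2.1 p.36] -/
theorem Φ_surjective (l : ℕ) : Function.Surjective (Φ l) := fun a => ⟨(a, 1), rfl⟩

/-- Preimages under `Φ` are open (`A` is discrete). (toy bookkeeping) [cite: MochizukiEtTh2009, Def 2.1 p.36] -/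
theorem isOpen_preimage_Φ (l : ℕ) (U : Set (HeisenbergWitness.heisPiC l)) : IsOpen (Φ l ⁻¹' U) := by
  have : Φ l ⁻¹' U = (Prod.fst : A l × Qc → A l) ⁻¹' (U : Set (A l)) := rfl
  rw [this]
  exact (@isOpen_discrete (A l) _ _ U).preimage continuous_fst

/-! ## 4. The tempered side `Q₀ ⊆ Q̂ × ℤ` -/

/-- Position-wise eventual constancy of a tower of configurations along the INTEGER positions:
for each `i ∈ ℤ` the lamp at position `i mod N_n` is eventually constant in `n`. (toy bookkeeping)
[cite: MochizukiEtTh2009, Lem 2.17(ii) p.58] -/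
def EvC (q : Qfull) : Prop :=
  ∀ i : ℤ, ∃ N : ℕ, ∃ c : S, ∀ n, N ≤ n → (q n).left (i : ZMod (Nl n)) = c

/-- **`Q₀ ⊆ Q̂ × ℤ`**: the coherent sequences whose rotation part IS the integer `k` at every level and
whose configurations are position-wise eventually constant, paired with `k` (their degree). As a subgroup
of the topological group `Q̂ × ℤ` it inherits the topology in which the degree is continuous — strictly
finer than the one induced from `Q̂`. (toy bookkeeping) [cite: MochizukiEtTh2009, Lem 2.17(ii) p.58] -/
def Q0 : Subgroup (Qc × Multiplicative ℤ) where
  carrier := {x | (∀ n, toAdd ((x.1 : Qfull) n).right = ((toAdd x.2 : ℤ) : ZMod (Nl n))) ∧ EvC x.1}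
  one_mem' := ⟨fun n => by simp, fun i => ⟨0, 1, fun n _ => rfl⟩⟩
  mul_mem' {x y} hx hy := by
    refine ⟨fun n => ?_, fun i => ?_⟩
    · simp only [Prod.fst_mul, Prod.snd_mul, Subgroup.coe_mul, Pi.mul_apply,
        SemidirectProduct.mul_right, toAdd_mul, hx.1 n, hy.1 n, Int.cast_add]
    · obtain ⟨N₁, c₁, h₁⟩ := hx.2 i
      obtain ⟨N₂, c₂, h₂⟩ := hy.2 (i - toAdd x.2)
      refine ⟨max N₁ N₂, c₁ * c₂, fun n hn => ?_⟩
      have e : ((x * y).1 : Qfull) n = (x.1 : Qfull) n * (y.1 : Qfull) n := rfl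
      rw [e, SemidirectProduct.mul_left, Pi.mul_apply, rot_apply, hx.1 n, h₁ n (le_of_max_le_left hn)]
      have : (i : ZMod (Nl n)) - ((toAdd x.2 : ℤ) : ZMod (Nl n)) =
          ((i - toAdd x.2 : ℤ) : ZMod (Nl n)) := by push_cast; ring
      rw [this, h₂ n (le_of_max_le_right hn)]
  inv_mem' {x} hx := by
    refine ⟨fun n => ?_, fun i => ?_⟩
    · simp only [Prod.fst_inv, Prod.snd_inv, Subgroup.coe_inv, Pi.inv_apply,
        SemidirectProduct.inv_right, toAdd_inv, hx.1 n, Int.cast_neg]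
    · obtain ⟨N, c, h⟩ := hx.2 (i + toAdd x.2)
      refine ⟨N, c⁻¹, fun n hn => ?_⟩
      have e : ((x⁻¹).1 : Qfull) n = ((x.1 : Qfull) n)⁻¹ := rfl
      have hc : (i : ZMod (Nl n)) + ((toAdd x.2 : ℤ) : ZMod (Nl n)) = ((i + toAdd x.2 : ℤ) : ZMod (Nl n)) := by
        push_cast; ring
      rw [e, SemidirectProduct.inv_left, rot_apply, Pi.inv_apply, toAdd_inv, sub_neg_eq_add, hx.1 n, hc,
        h n hn]

/-- Membership in `Q₀`. (toy bookkeeping) [cite: MochizukiEtTh2009, Lem 2.17(ii) p.58] -/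
theorem mem_Q0 {x : Qc × Multiplicative ℤ} :
    x ∈ Q0 ↔ (∀ n, toAdd ((x.1 : Qfull) n).right = ((toAdd x.2 : ℤ) : ZMod (Nl n))) ∧ EvC x.1 :=
  Iff.rfl

/-- `Q₀` as a type: a topological group with the subspace topology of `Q̂ × ℤ`. (toy bookkeeping)
[cite: MochizukiEtTh2009, Lem 2.17(ii) p.58] -/
abbrev Qt : Type := ↥Q0

/-- The degree `Q₀ → ℤ`. (toy bookkeeping) [cite: MochizukiEtTh2009, Lem 2.17(ii) p.58] -/
def deg : Qt →* Multiplicative ℤ := (MonoidHom.snd _ _).comp Q0.subtype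

/-- The completion map on the `Q`-factor, `ιQ : Q₀ → Q̂`. (toy bookkeeping) [cite: MochizukiEtTh2009, Lem 2.17(ii) p.58] -/
def ιQ : Qt →* Qc := (MonoidHom.fst _ _).comp Q0.subtype

/-- The degree is continuous. (toy bookkeeping) [cite: MochizukiEtTh2009, Lem 2.17(ii) p.58] -/
theorem continuous_deg : Continuous deg :=
  continuous_snd.comp continuous_subtype_val

/-- `ιQ` is continuous. (toy bookkeeping) [cite: MochizukiEtTh2009, Lem 2.17(ii) p.58] -/
theorem continuous_ιQ : Continuous ιQ :=
  continuous_fst.comp continuous_subtype_val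

/-- A nonzero integer is nonzero modulo `N_n` for all large `n`. (elementary; toy bookkeeping) [cite: MochizukiEtTh2009, Lem 2.17(ii) p.58] -/
theorem eventually_cast_ne_zero {z : ℤ} (hz : z ≠ 0) :
    ∃ N, ∀ n, N ≤ n → (z : ZMod (Nl n)) ≠ 0 := by
  refine ⟨z.natAbs, fun n hn h => ?_⟩
  rw [ZMod.intCast_zmod_eq_zero_iff_dvd] at h
  have h1 : (Nl n : ℤ) ≤ |z| := Int.le_of_dvd (abs_pos.mpr hz) ((Int.dvd_natAbs.mpr h).trans
    (by rw [Int.natCast_natAbs]))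
  have h2 := lt_Nl n
  have h3 : (z.natAbs : ℤ) = |z| := Int.natCast_natAbs z
  omega

/-- Two integers congruent modulo every `N_n` are equal. (elementary; toy bookkeeping) [cite: MochizukiEtTh2009, Lem 2.17(ii) p.58] -/
theorem int_eq_of_forall_cast_eq {a b : ℤ} (h : ∀ n, (a : ZMod (Nl n)) = (b : ZMod (Nl n))) : a = b := by
  by_contra hab
  obtain ⟨N, hN⟩ := eventually_cast_ne_zero (sub_ne_zero.mpr hab)
  exact hN N le_rfl (by rw [Int.cast_sub, h N, sub_self])

/-- `ιQ : Q₀ → Q̂` is injective (the degree is determined by the rotation parts). (toy bookkeeping)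
[cite: MochizukiEtTh2009, Lem 2.17(ii) p.58] -/
theorem ιQ_injective : Function.Injective ιQ := by
  rintro ⟨⟨q, k⟩, hq⟩ ⟨⟨q', k'⟩, hq'⟩ h
  change q = q' at h
  subst h
  have hk : toAdd k = toAdd k' := int_eq_of_forall_cast_eq fun n => by rw [← hq.1 n, ← hq'.1 n]
  have : k = k' := toAdd.injective hk
  subst this
  rfl

end Part_1

end LampModel

end ThetaCovers

end Literature.AnabelianGeometry.EtaleTheta
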